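import Summits.ABC.IUTFork.LDHTensor
import Summits.ABC.IUTFork.LDHHullSupport
import Literature.IUT.LogVolume.TensorPacketMShellUnramified
import HarnessLib

/-!
# The fork at [IUTchIII] Corollary 3.12, L-DH level (c312-3), II-e: [IUTchIV] Thm. 1.10 Step (vi) for the
# idele-built datum `DHData.ofIdelesM` (Mochizuki's shell normalisation) — NO sharpness hypothesis, NO region
# input — and the support of `hull(U_Θ)` in the degrees `1 ≤ j ≤ ℓ⋇`

Record-only file (D-0012) of the abc-iut cell (Cor. 3.12 sub-crew, seat abc-iut-c312-3; plan/D9PRIME-OBLIGATIONS.md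
row O3 for the MAIN-LINE model of the planner ruling R6: sharp (Ind3)-datum, Mochizuki's container); TAKES NO SIDE.
Mochizuki, *Inter-universal Teichmüller theory IV* (RIMS ms Apr. 2020 = PRIMS **57** (2021)), proof of Thm. 1.10,
Step (vi), kurims p. 29: "the inclusion “`φ((R_I)^∼) ⊆ (R_I)^∼`” of Proposition 1.4, (iv), implies that the tensor
product of log-shells under consideration contains the “union of possible images of a Θ-pilot object” … the
“container of possible images” is precisely equal to the tensor product of log-shells … Such an upper bound
“`0`”"; Prop. 1.2 (ii) "In particular", p. 10; Dupuy–Hilado, arXiv:2004.13228 (pre-split text) Def. 3.6.3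
(`ln ν̄_𝕃 = Σ_p ln ν̄_{𝕃_p}`, the average over `1 ≤ j ≤ ℓ⋇` only), §4.7, §4.9–4.12, read on the page.

WHAT THIS FILE PROVES (theorems only; no definitions, no named facts).
1. `lnνLp_hullUTheta_eq_zero_of_degrees`, `negLogThetaDHOn_eq_of_degrees`, `cor312DHLim_iff_of_degrees` — the
   stabilisation results of `LDHCor312Primes` (stated there under `HullSupportedOn T₀`, i.e. vanishing in EVERY
   degree `j`) need the vanishing only in the degrees `1 ≤ j ≤ ℓ⋇` that `ln ν̄_{𝕃_p}` actually averages over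
   (Def. 3.6.3); for ANY `DHData`.
2. `ofPrimesLine_prime_elim` — per-prime elimination for `DHData.ofPrimesLine` (abc-iut-c312-3's assembly of a
   `DHData` from packets and data given at primes): a property of (packet, `p`-component of `(O_𝕃(−P_Θ))^{Ind3}`,
   `p`-components of `t_Θ`) that holds for the GIVEN `(P p hp, (d p hp).bare3, (d p hp).tΘ)` holds for the assembled
   datum — the one place where the `dite`/transport of the assembly is unpacked.
3. **`logμ_hullUTheta_ofIdelesM_eq_zero`**: for the idele-built datum `DHData.ofIdelesM X 𝔽 t_Θ … T …`
   (`LDHTensor.lean`: Mochizuki's container `p^{−⌈d_I+a_I⌉}·log_p(R_I^×)` as the shell, the MINIMAL (Ind3)-datum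
   `O_𝕃(−P_Θ)` — built from the ideles alone), at every prime `p > 2` outside a set `dst ⊇ char(S)` over which the
   fields `K_{v̲}` (`v | p`) are absolutely unramified, EVERY component of `hull(U_Θ)` in the degrees `j ≥ 1` has
   `log μ̄ = 0`: the three summand-level facts of abc-iut-S2's `logμ_hullUTheta_eq_zero_of_shell` are THEOREMS there
   — `hshell` = `realPrimePacketM_shell_eq_O` (`p^{−⌈d_I+a_I⌉}·log_p(R_I^×) = (R_I)^∼`: `d_I = 0`, `a_I = |I|`,
   `log_p(R_I^×) = p^{|I|}·R_I`, `R_I = (R_I)^∼`; `TensorPacketMShellUnramified.lean`), `hhull` =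
   `realPrimePacketM_hullLoc_O`, `hbare` because the datum IS the bare region `t_{Θ,j,v_j}·O_{v⃗}` and `t_{Θ,j,v_j}` is
   a unit off `S` (`realPrimePacketM_peel_O_of_ordv_eq_zero`). NO sharpness hypothesis (sharp by construction) and
   NO region input — compare abc-iut-c312-d1's `hoff_ofTensor_of_sharp` (`LDHTensorStepVI.lean`) for Dupuy–Hilado's
   normalisation, where the (Ind3)-region is an input and sharpness a hypothesis.
4. `hoff_ofIdelesM` — the Step (vi) input `hoff` of the cell's local proof data (`LDHLocalProofData`,
   `localProofDataAvgOfDH`) for `ofIdelesM`, in the shape of c312-d1's `hoff_ofTensor_of_sharp`.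
5. `negLogThetaDHOn_ofIdelesM_eq`, `cor312DHLim_ofIdelesM_iff`, `cor312DHLim_ofIdelesM_iff_cor312DH` — for the
   idele-built datum the finite prime sums STABILISE off any `T₀ ⊇ {2} ∪ char(S) ∪ {p : some K_{v̲}, v | p,
   ramified}`: `ln ν̄_{𝕃,T'}(hull(U_Θ)) = ln ν̄_{𝕃,T₀}(hull(U_Θ))` for `T' ⊇ T₀`, and Dupuy–Hilado's (1.1) with `Σ_p`
   over ALL primes (`Cor312DHLim`) is EQUIVALENT to its truncation `Cor312DHOn T₀` — for `T₀ = T`, to `Cor312DH`.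
[cite: Mochizuki2012, IUTchIV Thm 1.10 proof Step (vi) p.29] [cite: Mochizuki2012, IUTchIV Prop. 1.2 (ii) p. 10]
[cite: DupuyHilado2025, Def. 3.6.3, §4.7, §4.9–4.12] [claim: Mochizuki2012, status: disputed]
HONEST SCOPE: every hypothesis is named (odd prime, unramified fields, `dst ⊇ char(S)`); `Cor312DH`/`Cor312DHOn`/
`Cor312DHLim` remain HYPOTHESES — nothing here asserts them or takes a side on Cor. 3.12; an instance ≠ an
endorsement; typed ≠ discharged elsewhere.
-/

noncomputable section

open Set Finset

namespace Summit.ABC.IUTFork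

open Literature.IUT.LogVolume NumberField IsDedekindDomain
open scoped Pointwise

variable {F : Type} [Field F] [NumberField F]

namespace DHData

/-! ## 1. Support of `hull(U_Θ)` in the degrees `1 ≤ j ≤ ℓ⋇` suffices for the stabilisation -/

section Degrees

variable (D : DHData F)

/-- If off `T₀` every component of `hull(U_Θ)` in the degrees `1 ≤ j ≤ ℓ⋇` has `log μ̄ = 0`, then
`ln ν̄_{𝕃_p}(hull(U_Θ)) = 0` for every prime `p ∉ T₀` (`ln ν̄_{𝕃_p}` averages over exactly these degrees).
[cite: DupuyHilado2025, Def. 3.6.3] -/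
theorem lnνLp_hullUTheta_eq_zero_of_degrees {T₀ : Finset ℕ}
    (hS : ∀ p : ℕ, p.Prime → p ∉ T₀ → ∀ j : ℕ, 1 ≤ j → j ≤ D.X.lstar →
      ∀ e : Fin (j + 1) → placesOver F p, D.M.logμ (D.M.hullUTheta D.ind3 p j e) = 0)
    {p : ℕ} (hp : p.Prime) (hpT : p ∉ T₀) : D.M.lnνLp D.X.lstar p (D.M.hullUTheta D.ind3) = 0 := by
  unfold PacketModel.lnνLp PacketModel.lnνTensorPower
  refine mul_eq_zero_of_right _ (Finset.sum_eq_zero fun i _ => Finset.sum_eq_zero fun e _ => ?_)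
  rw [hS p hp hpT ((i : ℕ) + 1) (by omega) (by have := i.2; omega) e, zero_mul]

/-- **Stabilisation from degree-restricted support**: `ln ν̄_{𝕃,T'}(hull(U_Θ)) = ln ν̄_{𝕃,T₀}(hull(U_Θ))` for every
finite set of primes `T' ⊇ T₀`. [cite: DupuyHilado2025, §1 p. 4, Def. 3.6.3] -/
theorem negLogThetaDHOn_eq_of_degrees {T₀ T' : Finset ℕ}
    (hS : ∀ p : ℕ, p.Prime → p ∉ T₀ → ∀ j : ℕ, 1 ≤ j → j ≤ D.X.lstar →
      ∀ e : Fin (j + 1) → placesOver F p, D.M.logμ (D.M.hullUTheta D.ind3 p j e) = 0)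
    (h : T₀ ⊆ T') (hT' : ∀ p ∈ T', p.Prime) : D.negLogThetaDHOn T' = D.negLogThetaDHOn T₀ := by
  unfold negLogThetaDHOn PacketModel.lnνL
  exact (Finset.sum_subset h fun p hp' hp₀ =>
    D.lnνLp_hullUTheta_eq_zero_of_degrees hS (hT' p hp') hp₀).symm

/-- Under degree-restricted support off `T₀`, all truncations to `T' ⊇ T₀` are EQUIVALENT to the one over `T₀`.
[claim: Mochizuki2012, status: disputed] -/
theorem cor312DHOn_iff_of_degrees {T₀ T' : Finset ℕ}
    (hS : ∀ p : ℕ, p.Prime → p ∉ T₀ → ∀ j : ℕ, 1 ≤ j → j ≤ D.X.lstar →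
      ∀ e : Fin (j + 1) → placesOver F p, D.M.logμ (D.M.hullUTheta D.ind3 p j e) = 0)
    (h : T₀ ⊆ T') (hT' : ∀ p ∈ T', p.Prime) : D.Cor312DHOn T' ↔ D.Cor312DHOn T₀ := by
  rw [Cor312DHOn, Cor312DHOn, D.negLogThetaDHOn_eq_of_degrees hS h hT']

/-- **(1.1) with `Σ_p` ⟺ the truncation to `T₀`** (`T ⊆ T₀`, primes) under degree-restricted support off `T₀`.
[claim: Mochizuki2012, status: disputed] -/
theorem cor312DHLim_iff_of_degrees {T₀ : Finset ℕ}
    (hS : ∀ p : ℕ, p.Prime → p ∉ T₀ → ∀ j : ℕ, 1 ≤ j → j ≤ D.X.lstar →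
      ∀ e : Fin (j + 1) → placesOver F p, D.M.logμ (D.M.hullUTheta D.ind3 p j e) = 0)
    (h : D.T ⊆ T₀) (hT₀ : ∀ p ∈ T₀, p.Prime) : D.Cor312DHLim ↔ D.Cor312DHOn T₀ := by
  constructor
  · rintro ⟨T₁, _, hT₁p, hall⟩
    have hU : ∀ p ∈ T₀ ∪ T₁, p.Prime := fun p hp =>
      (Finset.mem_union.mp hp).elim (hT₀ p) (hT₁p p)
    exact (D.cor312DHOn_iff_of_degrees hS Finset.subset_union_left hU).mp
      (hall (T₀ ∪ T₁) Finset.subset_union_right hU)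
  · exact fun hD => D.cor312DHLim_of_cor312DHOn h hT₀ hD

end Degrees

/-! ## 2. Per-prime elimination for `DHData.ofPrimesLine` -/

/-- Transport of a property of (packet, region, theta scalars) along an equality of prime packets.
[cite: DupuyHilado2025, Def. 3.6.3] -/
private theorem transport_elim {p : ℕ} {X : PilotData F} {Q Q' : PrimePacket F p} (hQ : Q = Q')
    (dd : Q'.DHDatum X)
    (C : (R : PrimePacket F p) → R.Region → (Fin X.lstar → (v : placesOver F p) → R.Λ v) → Prop)
    (h : C Q' dd.bare3 dd.tΘ) :
    C Q (PrimePacket.DHDatum.transport hQ dd).bare3 (PrimePacket.DHDatum.transport hQ dd).tΘ := by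
  subst hQ
  exact h

/-- **Per-prime elimination for `ofPrimesLine`**: at a prime `p`, any property of the triple (prime packet,
`p`-component of `(O_𝕃(−P_Θ))^{Ind3}`, `p`-components of the theta-idele) that holds for the GIVEN packet and datum
`(P p hp, (d p hp).bare3, (d p hp).tΘ)` holds for the `p`-part of the assembled `DHData.ofPrimesLine X P d T …`.
[cite: DupuyHilado2025, Def. 3.6.3, §3.9, §4.10] -/
theorem ofPrimesLine_prime_elim (X : PilotData F) (P : ∀ p : ℕ, p.Prime → PrimePacket F p)
    (d : ∀ (p : ℕ) (hp : p.Prime), (P p hp).DHDatum X)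
    (T : Finset ℕ) (T_prime : ∀ p ∈ T, p.Prime) (S_sub : ∀ v ∈ X.S, residueChar F v ∈ T)
    {p : ℕ} (hp : p.Prime)
    (C : (Q : PrimePacket F p) → Q.Region → (Fin X.lstar → (v : placesOver F p) → Q.Λ v) → Prop)
    (h : C (P p hp) (d p hp).bare3 (d p hp).tΘ) :
    C ((ofPrimesLine X P d T T_prime S_sub).M.primePart p) ((ofPrimesLine X P d T T_prime S_sub).ind3.bare3 p)
      (fun i v => (ofPrimesLine X P d T T_prime S_sub).tΘ i p v) := by
  classical
  unfold DHData.ofPrimesLine DHData.ofPrimewise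
  simp only [dif_pos hp]
  exact transport_elim (dif_pos hp) (d p hp) C h

/-! ## 3. Step (vi) for the idele-built datum `ofIdelesM` -/

section IdelesM

variable (X : PilotData F) (𝔽 : LocalFieldFamily F)
  (tΘ : ∀ (p : ℕ) (hp : p.Prime), Fin X.lstar → (v : placesOver F p) → (@LocalFields.k F _ _ p ⟨hp⟩ (𝔽 p hp) v)ˣ)
  (tΘ_ord : ∀ p hp (i : Fin X.lstar) (v : placesOver F p),
    @LocalFields.ordv F _ _ p ⟨hp⟩ (𝔽 p hp) v (tΘ p hp i v) = X.thetaPilot i v.1)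
  (tq : ∀ (p : ℕ) (hp : p.Prime), Fin X.lstar → (v : placesOver F p) → (@LocalFields.k F _ _ p ⟨hp⟩ (𝔽 p hp) v)ˣ)
  (tq_ord : ∀ p hp (i : Fin X.lstar) (v : placesOver F p),
    @LocalFields.ordv F _ _ p ⟨hp⟩ (𝔽 p hp) v (tq p hp i v) = X.qPilot v.1)
  (T : Finset ℕ) (T_prime : ∀ p ∈ T, p.Prime) (S_sub : ∀ v ∈ X.S, residueChar F v ∈ T)

/-- **Step (vi) at one summand for the idele-built datum**: at a prime `p > 2` outside `dst ⊇ char(S)` over which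
every `K_{v̲}` (`v | p`) is absolutely unramified, every component of `hull(U_Θ)` of `DHData.ofIdelesM X 𝔽 t_Θ … T …`
in a degree `j ≥ 1` has `log μ̄ = 0` — "the “container of possible images” is precisely equal to the tensor product
of log-shells … Such an upper bound “`0`”". NO sharpness hypothesis, NO region input.
[cite: Mochizuki2012, IUTchIV Thm 1.10 proof Step (vi) p.29] -/
theorem logμ_hullUTheta_ofIdelesM_eq_zero (dst : Finset ℕ) (hST : ∀ v ∈ X.S, residueChar F v ∈ dst)
    {p : ℕ} [hp : Fact p.Prime] (hpd : p ∉ dst) (hodd : 2 < p)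
    (hunram : ∀ v : placesOver F p, absRamificationIdx p ((𝔽 p hp.out).k v) = 1)
    {j : ℕ} (hj : 1 ≤ j) (e : Fin (j + 1) → placesOver F p) :
    (ofIdelesM X 𝔽 tΘ tΘ_ord tq tq_ord T T_prime S_sub).M.logμ
      ((ofIdelesM X 𝔽 tΘ tΘ_ord tq tq_ord T T_prime S_sub).M.hullUTheta
        (ofIdelesM X 𝔽 tΘ tΘ_ord tq tq_ord T T_prime S_sub).ind3 p j e) = 0 := by
  -- the places over `p` are outside `S` (`p ∉ dst ⊇ char(S)`)
  have hvS : ∀ v : placesOver F p, v.1 ∉ X.S := fun v hv => by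
    have h := hST v.1 hv
    rw [(mem_placesOver_iff_residueChar v.1).mp v.2] at h
    exact hpd h
  -- the three summand-level facts of `logμ_hullUTheta_eq_zero_of_shell`, for the GIVEN packet and datum at `p`,
  -- moved onto the assembled datum by the per-prime elimination
  have key := ofPrimesLine_prime_elim X (fun q hq => @realPrimePacketM F _ _ q ⟨hq⟩ (𝔽 q hq))
    (fun q hq => @PrimePacket.minimalDHDatumM F _ _ q ⟨hq⟩ (𝔽 q hq) X (tΘ q hq) (tΘ_ord q hq) (tq q hq)
      (tq_ord q hq)) T T_prime S_sub hp.out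
    (fun Q B _ => (∀ e' : Fin (j + 1) → placesOver F p, Q.shell j e' = Q.O j e') ∧
      (∀ e' : Fin (j + 1) → placesOver F p, Q.hullLoc j e' (Q.O j e') = Q.O j e') ∧
      (∀ e' : Fin (j + 1) → placesOver F p, B j e' ⊆ Q.O j e'))
    ⟨fun e' => realPrimePacketM_shell_eq_O p (𝔽 p hp.out) hodd hj e' (fun a => hunram (e' a)),
      fun e' => realPrimePacketM_hullLoc_O p (𝔽 p hp.out) e',
      fun e' => by
        -- the minimal datum IS the bare region `O_𝕃(−P_Θ)_{v⃗}`: a unit twist of `O_{v⃗}` off `S`, or `O_{v⃗}`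
        show (realPrimePacketM p (𝔽 p hp.out)).regionOf (tΘ p hp.out) j e' ⊆
          (realPrimePacketM p (𝔽 p hp.out)).O j e'
        unfold PrimePacket.regionOf
        split_ifs with hj'
        · have h0 : (𝔽 p hp.out).ordv (tΘ p hp.out ⟨j - 1, hj'.2⟩ (e' (Fin.last j))) = 0 := by
            rw [tΘ_ord p hp.out]
            exact (ofIdelesM X 𝔽 tΘ tΘ_ord tq tq_ord T T_prime S_sub).thetaPilot_apply_of_not_mem (hvS _) _
          exact (realPrimePacketM_peel_O_of_ordv_eq_zero p (𝔽 p hp.out) e' _ h0).subset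
        · exact subset_rfl⟩
  obtain ⟨hshell, hhull, hbare⟩ := key
  exact (ofIdelesM X 𝔽 tΘ tΘ_ord tq tq_ord T T_prime S_sub).logμ_hullUTheta_eq_zero_of_shell hST hp.out hpd
    hshell hhull hbare e

/-- **The Step (vi) input `hoff` for the idele-built datum** (the shape consumed by `localProofDataAvgOfDH`): for
`D = ofIdelesM X 𝔽 t_Θ … T …` and a set `dst ⊇ char(S)` such that every prime of `T ∖ dst` is odd with all `K_{v̲}`
(`v | p`) unramified, every component of `hull(U_Θ)` over `T ∖ dst` in the degrees `1 ≤ j ≤ ℓ⋇` has `log μ̄ ≤ 0`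
(in fact `= 0`). NO hypothesis beyond the ideles and the named arithmetic of the fields.
[cite: Mochizuki2012, IUTchIV Thm 1.10 proof Step (vi) p.29] [claim: Mochizuki2012, status: disputed] -/
theorem hoff_ofIdelesM (dst : Finset ℕ) (hST : ∀ v ∈ X.S, residueChar F v ∈ dst)
    (hodd : ∀ p ∈ T, p ∉ dst → 2 < p)
    (hunram : ∀ (p : ℕ) [hp : Fact p.Prime], p ∈ T → p ∉ dst → ∀ v : placesOver F p,
      absRamificationIdx p ((𝔽 p hp.out).k v) = 1) :
    ∀ p ∈ (ofIdelesM X 𝔽 tΘ tΘ_ord tq tq_ord T T_prime S_sub).T, p ∉ dst → ∀ j, 1 ≤ j →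
      j ≤ (ofIdelesM X 𝔽 tΘ tΘ_ord tq tq_ord T T_prime S_sub).X.lstar → ∀ e : Fin (j + 1) → placesOver F p,
        (ofIdelesM X 𝔽 tΘ tΘ_ord tq tq_ord T T_prime S_sub).M.logμ
          ((ofIdelesM X 𝔽 tΘ tΘ_ord tq tq_ord T T_prime S_sub).M.hullUTheta
            (ofIdelesM X 𝔽 tΘ tΘ_ord tq tq_ord T T_prime S_sub).ind3 p j e) ≤ 0 := by
  intro p hpT hpd j hj _ e
  haveI : Fact p.Prime := ⟨T_prime p hpT⟩
  exact (logμ_hullUTheta_ofIdelesM_eq_zero X 𝔽 tΘ tΘ_ord tq tq_ord T T_prime S_sub dst hST hpd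
    (hodd p hpT hpd) (hunram p hpT hpd) hj e).le

/-- **Stabilisation for the idele-built datum**: off any finite set `T₀ ⊇ char(S)` outside which every prime is
odd with all `K_{v̲}` unramified (e.g. `T₀ ⊇ {2} ∪ char(S) ∪` the ramified primes), `ln ν̄_{𝕃,T'}(hull(U_Θ)) =
ln ν̄_{𝕃,T₀}(hull(U_Θ))` for every finite set of primes `T' ⊇ T₀` — the finite sum IS Dupuy–Hilado's `Σ_p`.
[cite: DupuyHilado2025, §1 p. 4, Def. 3.6.3] [cite: Mochizuki2012, IUTchIV Thm 1.10 proof Step (vi) p.29] -/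
theorem negLogThetaDHOn_ofIdelesM_eq (T₀ : Finset ℕ) (hST : ∀ v ∈ X.S, residueChar F v ∈ T₀)
    (hodd : ∀ p : ℕ, p.Prime → p ∉ T₀ → 2 < p)
    (hunram : ∀ (p : ℕ) [hp : Fact p.Prime], p ∉ T₀ → ∀ v : placesOver F p,
      absRamificationIdx p ((𝔽 p hp.out).k v) = 1)
    {T' : Finset ℕ} (h : T₀ ⊆ T') (hT' : ∀ p ∈ T', p.Prime) :
    (ofIdelesM X 𝔽 tΘ tΘ_ord tq tq_ord T T_prime S_sub).negLogThetaDHOn T' =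
      (ofIdelesM X 𝔽 tΘ tΘ_ord tq tq_ord T T_prime S_sub).negLogThetaDHOn T₀ :=
  (ofIdelesM X 𝔽 tΘ tΘ_ord tq tq_ord T T_prime S_sub).negLogThetaDHOn_eq_of_degrees
    (fun p hp hpT j hj _ e => by
      haveI : Fact p.Prime := ⟨hp⟩
      exact logμ_hullUTheta_ofIdelesM_eq_zero X 𝔽 tΘ tΘ_ord tq tq_ord T T_prime S_sub T₀ hST hpT
        (hodd p hp hpT) (hunram p hpT) hj e)
    h hT'

/-- **For the idele-built datum, (1.1) with `Σ_p` over ALL primes ⟺ its truncation to `T₀`** (`T ⊆ T₀`, primes,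
outside `T₀` every prime odd with unramified fields). HYPOTHESES on both sides; nothing asserted.
[claim: Mochizuki2012, status: disputed] -/
theorem cor312DHLim_ofIdelesM_iff (T₀ : Finset ℕ) (hT : T ⊆ T₀) (hT₀ : ∀ p ∈ T₀, p.Prime)
    (hodd : ∀ p : ℕ, p.Prime → p ∉ T₀ → 2 < p)
    (hunram : ∀ (p : ℕ) [hp : Fact p.Prime], p ∉ T₀ → ∀ v : placesOver F p,
      absRamificationIdx p ((𝔽 p hp.out).k v) = 1) :
    (ofIdelesM X 𝔽 tΘ tΘ_ord tq tq_ord T T_prime S_sub).Cor312DHLim ↔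
      (ofIdelesM X 𝔽 tΘ tΘ_ord tq tq_ord T T_prime S_sub).Cor312DHOn T₀ :=
  (ofIdelesM X 𝔽 tΘ tΘ_ord tq tq_ord T T_prime S_sub).cor312DHLim_iff_of_degrees
    (fun p hp hpT j hj _ e => by
      haveI : Fact p.Prime := ⟨hp⟩
      exact logμ_hullUTheta_ofIdelesM_eq_zero X 𝔽 tΘ tΘ_ord tq tq_ord T T_prime S_sub T₀
        (fun v hv => hT (S_sub v hv)) hpT (hodd p hp hpT) (hunram p hpT) hj e)
    hT hT₀

/-- In particular, when `T` itself contains `2`, `char(S)` and every prime under a ramified `K_{v̲}` — i.e. outside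
`T` every prime is odd with unramified fields — Dupuy–Hilado's (1.1) with `Σ_p` over ALL primes is EQUIVALENT to
the landed finite form `Cor312DH` of the idele-built datum. HYPOTHESES on both sides; nothing asserted.
[claim: Mochizuki2012, status: disputed] -/
theorem cor312DHLim_ofIdelesM_iff_cor312DH (hodd : ∀ p : ℕ, p.Prime → p ∉ T → 2 < p)
    (hunram : ∀ (p : ℕ) [hp : Fact p.Prime], p ∉ T → ∀ v : placesOver F p,
      absRamificationIdx p ((𝔽 p hp.out).k v) = 1) :
    (ofIdelesM X 𝔽 tΘ tΘ_ord tq tq_ord T T_prime S_sub).Cor312DHLim ↔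
      (ofIdelesM X 𝔽 tΘ tΘ_ord tq tq_ord T T_prime S_sub).Cor312DH :=
  cor312DHLim_ofIdelesM_iff X 𝔽 tΘ tΘ_ord tq tq_ord T T_prime S_sub T le_rfl T_prime hodd hunram

end IdelesM

end DHData

end Summit.ABC.IUTFork

end
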